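import Mathlib
import Literature.Analysis.FluidPDE.Tao2016AveragedNS.BoundedEternalSolutions
import Summits.NavierStokesRegularity.NavierStokesRegularity.Theorems.TaoLadderRungTwoBreakNoSurvivingEternalViscBddOneWakeDyadicDSSMasterIdentity

/-!
# Crux `TaoLadderRungTwoBreak.NoSurvivingEternalViscBddOne` (stmt-NavierStokesRegularity-20419) / ⟨20205⟩ `NoSurvivingDSSOne`, DYADIC
# MEMBER, DSS STRATUM: LAG RIGIDITY — the lag defect of a lit shell is STRICTLY positive (no DSS front has proportional consecutive
# shells), hence BEYOND THE (S₁) THRESHOLD EVERY LIT SHELL HAS STRICTLY NEGATIVE LAG ENERGY; BY-NAME versions for the tree's DSS waves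

MODEL lattice ODEs only (non-negative period-one DSS solutions `V_{k+1}(t) = κV_k(κt)`, `0 < κ < Λ`, of the Katz–Pavlović chain in Tao's
critical variables; the tree's single-profile `IsDSSWave ε₀ dyadicTable π T Φ`); nothing in this file is a statement about the Navier–Stokes
equations, and no stub, crux, rung or summit is proved by it (`--supports stmt-NavierStokesRegularity-20419`).  DEF-FREE.

* `dss_selfsimilar_iterate`, `dss_selfsimilar_trivial` — if `V_{n+1} = √κ·V_n` at every `t < 0` on a DSS solution (`κ > 1`), then `V_n(t/κ^j) = κ^{j/2}V_n(t)`: a shell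
  positive somewhere is unbounded near `0⁻`, so a shell with a (finite) terminal value is identically zero;
* **`lagDefect_pos`** — hence on a lit shell (`v_n > 0`) the lag defect `D_n = ∫(√κV_n² − 2V_nV_{n+1} + V_{n+1}²/√κ)` is STRICTLY positive
  (continuity: a continuous non-negative integrand with zero integral vanishes, and then `V_{n+1} = √κV_n`);
* **`lagEnergy_neg_of_threshold`** — with `…DSSMasterIdentity.overshoot_excess_of_threshold`: if `2κ² − κ√κ ≥ Λ²` (beyond the (S₁)
  threshold as the base tends to one) then `∫V_{n-1}²(V_n − v_n) > 0` on every lit shell: the feeding-shell-weighted OVERSHOOT STRICTLY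
  DOMINATES THE LAG for every survivor beyond the threshold;
* `dssWave_lagDefect_pos`, `dssWave_lagEnergy_neg_of_threshold` — BY NAME for admissible single-profile DSS waves of `dyadicTable`
  (`κ = e^{T}`, `dssMu ε₀ T < 1`, lit shell `(r_n)₀ > 0`).

HONEST LABEL: elementary real analysis on top of the hand's identity files; W1-dyadic, (ρ0), ⟨20419⟩, ⟨20205⟩ and every NS statement remain
OPEN; rung 0.
-/

-- the summit and its single sub-problem share the name (CONVENTIONS §1)
set_option linter.dupNamespace false

namespace Summit.NavierStokesRegularity.NavierStokesRegularity.Theorems.NoSurvivingEternalViscBddOne.DSSLagRigidity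

open Filter Topology Set MeasureTheory Finset
open Literature.Analysis.FluidPDE.TaoCascade
open Summit.NavierStokesRegularity.NavierStokesRegularity.Theorems.NoSurvivingEternalViscBddOne
open Summit.NavierStokesRegularity.NavierStokesRegularity.Theorems.NoSurvivingEternalViscBddOne.WakeCriterion
  (dyadic_crit_hasDerivAt dyadic_crit_tendsto dyadic_classical_hyp_nonneg)

variable {ε₀ κ : ℝ} {V : ℤ → ℝ → ℝ} {v : ℤ → ℝ} {P : ℤ → ℝ → ℝ}

/-! ## Proportional consecutive shells force the trivial shell -/

/-- If `V_{n+1}(t) = √κ·V_n(t)` for all `t < 0` on a DSS solution, then `V_n(t/κ^j) = (√κ)^j·V_n(t)` for every `j` and `t < 0`.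
[elementary] -/
theorem dss_selfsimilar_iterate (hκ : 1 < κ)
    (hdss : ∀ (n : ℤ) (t : ℝ), t < 0 → V (n + 1) t = κ * V n (κ * t))
    (n : ℤ) (hprop : ∀ t : ℝ, t < 0 → V (n + 1) t = Real.sqrt κ * V n t) (j : ℕ) {t : ℝ} (ht : t < 0) :
    V n (t / κ ^ j) = Real.sqrt κ ^ j * V n t := by
  have hκ0 : 0 < κ := by linarith
  have hs : 0 < Real.sqrt κ := Real.sqrt_pos.2 hκ0
  have hss : Real.sqrt κ * Real.sqrt κ = κ := Real.mul_self_sqrt hκ0.le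
  -- one step: `V_n(s/κ) = √κ·V_n(s)` for `s < 0`
  have step : ∀ s : ℝ, s < 0 → V n (s / κ) = Real.sqrt κ * V n s := by
    intro s hs0
    have hsk : s / κ < 0 := div_neg_of_neg_of_pos hs0 hκ0
    have h1 := hdss n (s / κ) hsk          -- V(n+1)(s/κ) = κ V n s
    rw [mul_div_cancel₀ _ hκ0.ne'] at h1
    have h2 := hprop (s / κ) hsk           -- V(n+1)(s/κ) = √κ V n (s/κ)
    rw [h1] at h2
    -- κ V n s = √κ V n (s/κ)  ⟹  V n (s/κ) = √κ V n s
    have : Real.sqrt κ * V n (s / κ) = Real.sqrt κ * (Real.sqrt κ * V n s) := by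
      rw [← mul_assoc, hss]; exact h2.symm
    exact mul_left_cancel₀ hs.ne' this
  induction j with
  | zero => simp
  | succ m ih =>
    have hm : t / κ ^ m < 0 := div_neg_of_neg_of_pos ht (pow_pos hκ0 m)
    rw [pow_succ, ← div_div, step _ hm, ih, pow_succ]
    ring

/-- **Proportional consecutive shells force the trivial shell.**  On a DSS solution with `κ > 1`, if `V_{n+1} = √κ·V_n` on `t < 0` and
`V_n` has a terminal value `v_n` (`t ↑ 0`), then `V_n ≡ 0` on `t < 0` (and so `v_n = 0`). [elementary] -/
theorem dss_selfsimilar_trivial (hκ : 1 < κ)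
    (hdss : ∀ (n : ℤ) (t : ℝ), t < 0 → V (n + 1) t = κ * V n (κ * t))
    (hpos : ∀ (n : ℤ) (t : ℝ), t < 0 → 0 ≤ V n t)
    (hv : ∀ n : ℤ, Tendsto (V n) (𝓝[<] 0) (𝓝 (v n)))
    (n : ℤ) (hprop : ∀ t : ℝ, t < 0 → V (n + 1) t = Real.sqrt κ * V n t) {t : ℝ} (ht : t < 0) :
    V n t = 0 := by
  have hκ0 : 0 < κ := by linarith
  have hs1 : 1 < Real.sqrt κ := by
    rw [show (1 : ℝ) = Real.sqrt 1 from Real.sqrt_one.symm]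
    exact Real.sqrt_lt_sqrt zero_le_one hκ
  by_contra hne
  have hVpos : 0 < V n t := lt_of_le_of_ne (hpos n t ht) (Ne.symm hne)
  -- the sequence `t/κ^j → 0⁻` and `V_n(t/κ^j) = (√κ)^j V_n t → ∞`, contradicting the terminal limit
  have hseq : Tendsto (fun j : ℕ => t / κ ^ j) atTop (𝓝[<] (0 : ℝ)) := by
    have h1 : Tendsto (fun j : ℕ => t / κ ^ j) atTop (𝓝 0) := by
      have h := (tendsto_pow_atTop_nhds_zero_of_lt_one (inv_nonneg.2 hκ0.le) (inv_lt_one_of_one_lt₀ hκ)).const_mul t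
      rw [mul_zero] at h
      refine h.congr fun j => ?_
      rw [inv_pow, div_eq_mul_inv]
    refine tendsto_nhdsWithin_of_tendsto_nhds_of_eventually_within _ h1 (Eventually.of_forall fun j => ?_)
    exact div_neg_of_neg_of_pos ht (pow_pos hκ0 j)
  have hlim : Tendsto (fun j : ℕ => V n (t / κ ^ j)) atTop (𝓝 (v n)) := (hv n).comp hseq
  have hgrow : Tendsto (fun j : ℕ => V n (t / κ ^ j)) atTop atTop := by
    have h := (tendsto_pow_atTop_atTop_of_one_lt hs1).atTop_mul_const hVpos
    refine h.congr fun j => ?_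
    rw [dss_selfsimilar_iterate hκ hdss n hprop j ht]
  exact not_tendsto_nhds_of_tendsto_atTop hgrow (v n) hlim

/-! ## The lag defect of a lit shell is strictly positive -/

/-- **LAG RIGIDITY**: on a non-negative DSS solution with `κ > 1`, every lit shell (`v_n > 0`) has a STRICTLY positive lag defect
`0 < ∫_{(−∞,0)} (√κ·V_n² − 2V_nV_{n+1} + V_{n+1}²/√κ)`.
[cite: Tao2016AveragedNS, §1.2, §4 Lemma 4.1 (4.8), §6.4; elementary] -/
theorem lagDefect_pos (hκ : 1 < κ)
    (hV : ∀ (n : ℤ) (t : ℝ), t < 0 →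
      HasDerivAt (V n) (bigLam ε₀ * V (n - 1) t ^ 2 - (bigLam ε₀)⁻¹ * (V n t * V (n + 1) t)) t)
    (hpos : ∀ (n : ℤ) (t : ℝ), t < 0 → 0 ≤ V n t)
    (hdss : ∀ (n : ℤ) (t : ℝ), t < 0 → V (n + 1) t = κ * V n (κ * t))
    (hv : ∀ n : ℤ, Tendsto (V n) (𝓝[<] 0) (𝓝 (v n)))
    (hsq : ∀ k : ℤ, IntegrableOn (fun t => V k t ^ 2) (Iio 0))
    (hdr : ∀ k : ℤ, IntegrableOn (fun t => V k t * V (k + 1) t) (Iio 0))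
    (n : ℤ) (hvn : 0 < v n) :
    0 < ∫ t in Iio 0, (Real.sqrt κ * V n t ^ 2 - 2 * (V n t * V (n + 1) t) + (Real.sqrt κ)⁻¹ * V (n + 1) t ^ 2) := by
  have hκ0 : 0 < κ := by linarith
  have hs : 0 < Real.sqrt κ := Real.sqrt_pos.2 hκ0
  set g : ℝ → ℝ := fun t => Real.sqrt κ * V n t ^ 2 - 2 * (V n t * V (n + 1) t) + (Real.sqrt κ)⁻¹ * V (n + 1) t ^ 2 with hg
  have hgnn : ∀ t, 0 ≤ g t := fun t => DSSLagDefect.lagDefect_integrand_nonneg hκ0 _ _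
  have hgint : IntegrableOn g (Iio 0) :=
    (((hsq n).const_mul _).sub ((hdr n).const_mul _)).add ((hsq (n + 1)).const_mul _)
  have hgcont : ContinuousOn g (Iio 0) := by
    have hc : ∀ k : ℤ, ContinuousOn (V k) (Iio 0) := fun k t ht => (hV k t ht).continuousAt.continuousWithinAt
    exact ((continuousOn_const.mul ((hc n).pow 2)).sub (continuousOn_const.mul ((hc n).mul (hc (n + 1))))).add
      (continuousOn_const.mul ((hc (n + 1)).pow 2))
  -- if the defect vanished, the integrand would vanish on `t < 0`
  by_contra hle
  have hD0 : ∫ t in Iio 0, g t = 0 := le_antisymm (not_lt.1 hle) (setIntegral_nonneg measurableSet_Iio fun t _ => hgnn t)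
  have hzero : ∀ t : ℝ, t < 0 → g t = 0 := by
    intro t ht
    by_contra hne
    have hgt : 0 < g t := lt_of_le_of_ne (hgnn t) (Ne.symm hne)
    -- continuity gives a window `[t - δ, t]` on which `g ≥ g t / 2`
    have hct : ContinuousAt g t := (hgcont t ht).continuousAt (Iio_mem_nhds ht)
    have hev : ∀ᶠ s in 𝓝 t, g t / 2 < g s := hct.eventually (lt_mem_nhds (by linarith))
    obtain ⟨δ, hδ, hball⟩ := Metric.eventually_nhds_iff.1 hev
    set δ' := min (δ / 2) 1 with hδ'
    have hδ'pos : 0 < δ' := lt_min (by linarith) one_pos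
    have hsub : Icc (t - δ') t ⊆ Iio 0 := fun s hs => lt_of_le_of_lt hs.2 ht
    have hwin : ∀ s ∈ Icc (t - δ') t, g t / 2 ≤ g s := by
      intro s hs
      have hdist : dist s t < δ := by
        rw [Real.dist_eq, abs_lt]
        constructor <;> nlinarith [hs.1, hs.2, min_le_left (δ / 2) 1]
      exact (hball hdist).le
    have hlow := setIntegral_ge_of_const_le_real measurableSet_Icc (by exact measure_Icc_lt_top.ne) hwin
      (hgint.mono_set hsub)
    have hvol : (volume : Measure ℝ).real (Icc (t - δ') t) = δ' := by
      rw [Measure.real, Real.volume_Icc, ENNReal.toReal_ofReal (by linarith)]; ring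
    rw [hvol] at hlow
    have hmono : ∫ s in Icc (t - δ') t, g s ≤ ∫ s in Iio 0, g s :=
      setIntegral_mono_set hgint (ae_of_all _ hgnn) hsub.eventuallyLE
    have : 0 < g t / 2 * δ' := by positivity
    linarith
  -- hence `V_{n+1} = √κ V_n` on `t < 0`
  have hprop : ∀ t : ℝ, t < 0 → V (n + 1) t = Real.sqrt κ * V n t := by
    intro t ht
    have h := hzero t ht
    have e : g t = (Real.sqrt κ * V n t - V (n + 1) t) ^ 2 / Real.sqrt κ := by
      simp only [hg]; field_simp; ring
    rw [e, div_eq_zero_iff, or_iff_left hs.ne'] at h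
    have := pow_eq_zero_iff (n := 2) two_ne_zero |>.1 h
    linarith
  -- so shell `n` is trivial, contradicting `v_n > 0`
  have hVz : ∀ t : ℝ, t < 0 → V n t = 0 := fun t ht => dss_selfsimilar_trivial hκ hdss hpos hv n hprop ht
  have hv0 : v n = 0 := by
    have h : Tendsto (V n) (𝓝[<] 0) (𝓝 0) :=
      tendsto_const_nhds.congr' (eventually_nhdsWithin_of_forall fun t ht => (hVz t ht).symm)
    exact tendsto_nhds_unique (hv n) h
  linarith

/-- **STRICTLY NEGATIVE LAG ENERGY BEYOND THE THRESHOLD.**  Under the hypotheses of `…DSSMasterIdentity.overshoot_excess_of_threshold` with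
`κ > 1`, if `2κ² − κ√κ ≥ Λ²` then on every lit shell `∫_{(−∞,0)} V_{n-1}²(V_n − v_n) > 0`: the feeding-shell-weighted overshoot strictly
dominates the lag.  [cite: Tao2016AveragedNS, §1.2, §4 Lemma 4.1 (4.8)–(4.10), §6.4; elementary] -/
theorem lagEnergy_neg_of_threshold (hε : 0 < ε₀) (hκ : 1 < κ) (hκΛ : κ < bigLam ε₀)
    (hV : ∀ (n : ℤ) (t : ℝ), t < 0 →
      HasDerivAt (V n) (bigLam ε₀ * V (n - 1) t ^ 2 - (bigLam ε₀)⁻¹ * (V n t * V (n + 1) t)) t)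
    (hpos : ∀ (n : ℤ) (t : ℝ), t < 0 → 0 ≤ V n t)
    (hdss : ∀ (n : ℤ) (t : ℝ), t < 0 → V (n + 1) t = κ * V n (κ * t))
    (hP : ∀ k t, P k t = 2 * (((bigLam ε₀ ^ k)⁻¹) ^ 2 * (bigLam ε₀)⁻¹) * (V k t ^ 2 * V (k + 1) t))
    (hv : ∀ n : ℤ, Tendsto (V n) (𝓝[<] 0) (𝓝 (v n)))
    (hpast : ∀ k : ℤ, Tendsto (V k) atBot (𝓝 0))
    (hsq : ∀ k : ℤ, IntegrableOn (fun t => V k t ^ 2) (Iic 0))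
    (hdr : ∀ k : ℤ, IntegrableOn (fun t => V k t * V (k + 1) t) (Iic 0))
    (hPint : ∀ k : ℤ, IntegrableOn (P k) (Iic 0))
    (hthr : bigLam ε₀ ^ 2 ≤ 2 * κ ^ 2 - κ * Real.sqrt κ) (n : ℤ) (hvn : 0 < v n) :
    0 < -(∫ t in Iio 0, V (n - 1) t ^ 2 * (v n - V n t)) := by
  have hΛ : 0 < bigLam ε₀ := bigLam_pos (by linarith)
  have hκ0 : 0 < κ := by linarith
  have hsqrt : Real.sqrt κ < bigLam ε₀ := by
    rw [Real.sqrt_lt' hΛ]; nlinarith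
  have hgap : 0 < bigLam ε₀ ^ 2 - κ * Real.sqrt κ := by
    have : κ * Real.sqrt κ < bigLam ε₀ * bigLam ε₀ := mul_lt_mul'' hκΛ hsqrt hκ0.le (Real.sqrt_nonneg κ)
    nlinarith
  have h := DSSMasterIdentity.overshoot_excess_of_threshold hε hκ0 hκΛ hV hpos hdss hP hv hpast hsq hdr hPint hthr n
  have hD := lagDefect_pos hκ hV hpos hdss hv (fun k => (hsq k).mono_set Iio_subset_Iic_self)
    (fun k => (hdr k).mono_set Iio_subset_Iic_self) n hvn
  have : 0 < v n * (∫ t in Iio 0, (Real.sqrt κ * V n t ^ 2 - 2 * (V n t * V (n + 1) t)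
      + (Real.sqrt κ)⁻¹ * V (n + 1) t ^ 2)) / (2 * (bigLam ε₀ ^ 2 - κ * Real.sqrt κ)) := by positivity
  linarith

/-! ## By name: the tree's single-profile DSS waves of the dyadic member -/

section DSS

variable {perm : Equiv.Perm (Fin 1)} {T : ℝ} {Φ : Fin 1 → ℝ → Em 4} {r₀ : Fin 1}

/-- **No admissible single-profile DSS wave of the dyadic member has proportional consecutive shells**: for `T > 0`, `dssMu ε₀ T < 1` and a
lit shell `(r_n)₀ > 0`, the lag defect of the critical variable is strictly positive (`κ = e^{T}`).
[cite: Tao2016AveragedNS, §1.2, §4, §6.4; elementary] -/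
theorem dssWave_lagDefect_pos (hε : 0 < ε₀) (hΦ : IsDSSWave ε₀ dyadicTable perm T Φ)
    {r : ℤ → Em 4} (hr : ∀ k : ℤ, Tendsto (fun σ : ℝ => Real.exp σ • dssEmbed perm T Φ r₀ k σ) atTop (𝓝 (r k)))
    {n : ℤ} (hn : 0 < r n 0) :
    0 < ∫ t in Iio 0, (Real.sqrt (Real.exp T) * ((-t)⁻¹ * (dssEmbed perm T Φ r₀ n (-Real.log (-t))) 0) ^ 2
        - 2 * (((-t)⁻¹ * (dssEmbed perm T Φ r₀ n (-Real.log (-t))) 0)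
            * ((-t)⁻¹ * (dssEmbed perm T Φ r₀ (n + 1) (-Real.log (-t))) 0))
        + (Real.sqrt (Real.exp T))⁻¹ * ((-t)⁻¹ * (dssEmbed perm T Φ r₀ (n + 1) (-Real.log (-t))) 0) ^ 2) := by
  have hW : IsEternal ε₀ dyadicTable (dssEmbed perm T Φ r₀) := hΦ.isEternal_dssEmbed r₀
  obtain ⟨hpos, -⟩ := dyadic_classical_hyp_nonneg hε hW
  have hκ1 : 1 < Real.exp T := Real.one_lt_exp_iff.2 hΦ.delay_pos
  exact lagDefect_pos (V := fun (k : ℤ) (s : ℝ) => (-s)⁻¹ * (dssEmbed perm T Φ r₀ k (-Real.log (-s))) 0)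
    (v := fun k => r k 0) hκ1
    (fun k t ht => dyadic_crit_hasDerivAt hW k ht) hpos (fun k t ht => DSSFrontOvershoot.crit_dss T Φ perm r₀ k ht)
    (fun k => dyadic_crit_tendsto hr k)
    (fun k => (DSSFrontOvershoot.crit_integrableOn_sq hε hW k).mono_set Iio_subset_Iic_self)
    (fun k => (DSSFrontOvershoot.crit_integrableOn_mul hε hW k).mono_set Iio_subset_Iic_self) n hn

/-- **Beyond the threshold, every lit shell of an admissible single-profile DSS wave of the dyadic member has strictly negative lag
energy**: with `κ = e^{T}`, `dssMu ε₀ T < 1`, `2κ² − κ√κ ≥ Λ²` and `(r_n)₀ > 0`: `∫_{(−∞,0)} V_{n-1}²(V_n − (r_n)₀) > 0`.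
[cite: Tao2016AveragedNS, §1.2, §4, §6.4; elementary] -/
theorem dssWave_lagEnergy_neg_of_threshold (hε : 0 < ε₀) (hΦ : IsDSSWave ε₀ dyadicTable perm T Φ) (hμ : dssMu ε₀ T < 1)
    {r : ℤ → Em 4} (hr : ∀ k : ℤ, Tendsto (fun σ : ℝ => Real.exp σ • dssEmbed perm T Φ r₀ k σ) atTop (𝓝 (r k)))
    (hthr : bigLam ε₀ ^ 2 ≤ 2 * Real.exp T ^ 2 - Real.exp T * Real.sqrt (Real.exp T))
    {n : ℤ} (hn : 0 < r n 0) :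
    0 < -(∫ t in Iio 0, ((-t)⁻¹ * (dssEmbed perm T Φ r₀ (n - 1) (-Real.log (-t))) 0) ^ 2
        * (r n 0 - (-t)⁻¹ * (dssEmbed perm T Φ r₀ n (-Real.log (-t))) 0)) := by
  have hW : IsEternal ε₀ dyadicTable (dssEmbed perm T Φ r₀) := hΦ.isEternal_dssEmbed r₀
  obtain ⟨hpos, -⟩ := dyadic_classical_hyp_nonneg hε hW
  have hκ1 : 1 < Real.exp T := Real.one_lt_exp_iff.2 hΦ.delay_pos
  exact lagEnergy_neg_of_threshold
    (V := fun (k : ℤ) (s : ℝ) => (-s)⁻¹ * (dssEmbed perm T Φ r₀ k (-Real.log (-s))) 0)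
    (v := fun k => r k 0)
    (P := fun (k : ℤ) (s : ℝ) => 2 * (((bigLam ε₀ ^ k)⁻¹) ^ 2 * (bigLam ε₀)⁻¹) *
      (((-s)⁻¹ * (dssEmbed perm T Φ r₀ k (-Real.log (-s))) 0) ^ 2 *
        ((-s)⁻¹ * (dssEmbed perm T Φ r₀ (k + 1) (-Real.log (-s))) 0)))
    hε hκ1 (DSSFrontOvershoot.exp_lt_bigLam_of_dssMu_lt_one hε hμ)
    (fun k t ht => dyadic_crit_hasDerivAt hW k ht) hpos (fun k t ht => DSSFrontOvershoot.crit_dss T Φ perm r₀ k ht)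
    (fun k t => rfl) (fun k => dyadic_crit_tendsto hr k) (fun k => DSSFrontOvershoot.crit_tendsto_atBot hε hW k)
    (fun k => DSSFrontOvershoot.crit_integrableOn_sq hε hW k) (fun k => DSSFrontOvershoot.crit_integrableOn_mul hε hW k)
    (fun k => DSSFrontOvershoot.crit_integrableOn_flux hε hW k) hthr n hn

end DSS

end Summit.NavierStokesRegularity.NavierStokesRegularity.Theorems.NoSurvivingEternalViscBddOne.DSSLagRigidity
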